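import Mathlib
import HarnessLib
import HarnessLib.Audit
import Summits.FinalStateConjecture.Statement
import Literature.Geometry.Lorentzian.WeightedNorms
import Literature.Geometry.Lorentzian.KerrConvergence
import Literature.Geometry.Lorentzian.KerrSchild
import Literature.Geometry.Lorentzian.LeviCivita
import HarnessLib.Audit.Status.Attr

/-!
Route: RecedingRepeller

# Route RecedingRepeller — Inter-hole trapping dissolves uniformly; receding multi-Kerr is a basin;
generic data shadow it

X = MultiKerrBasin ("it suffices to show", given the complementary crux GenericShadowing): there are
a differentiability order k and a
positive tolerance ε(N, masses, spins, motions) such that for EVERY admissible datum (not only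
generic ones) and every MGHD with complete 𝓘⁺,
if the exterior eventually-and-forever carries N sub-extremal boosted-Kerr near-zone charts (radii
Rᵢ(τ) → ∞) and a flat radiation-zone chart on
the late half-space minus sublinear tubes, (Cᵏ, ε)-close on every slab, pairwise separating, with
the exhaustive causal covering of the Statement
(an ε-SHADOW of a receding N-Kerr configuration), then that MGHD settles down in the sense of the
Statement (C² FinalStateDecomposition with
sub-extremal holes, O = exteriorOf, HasExhaustiveCharts). Orbital ⇒ asymptotic stability of receding
multi-Kerr is a decay statement for the
linearised flow on backgrounds shadowing N far-apart holes; its only ingredient with no existing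
technology is uniform-in-time integrated decay
across the INTER-HOLE trapped set (card fractal-uncertainty-between-black-holes: an Ikawa/Cantor
repeller between the photon spheres, pressure gap
by Ikawa–Nonnenmacher–Zworski or pressure-free by the fractal uncertainty principle, dissolving like
log(D)/D as the holes recede) — isolated as
the scalar model cruxes RecedingSKSDecay (rank 2) and StaticSKSDecay (rank 3) on explicit superposed
Kerr–Schild two-hole backgrounds.
GenericShadowing (rank 4) is the remainder: generic data have an MGHD, complete 𝓘⁺, and ε-shadow
SOME receding multi-Kerr configuration for
every positive tolerance.
Lean: `∃ (k : ℕ) (ε : (N : ℕ) → (Fin N → ℝ) → (Fin N → ℝ) → (Fin N →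
↥Literature.Geometry.Lorentzian.lorentzGroup × Literature.Geometry.Lorentzian.E4) → ENNReal), (∀ (N
: ℕ) (mass spin : Fin N → ℝ) (motion : Fin N → ↥Literature.Geometry.Lorentzian.lorentzGroup ×
Literature.Geometry.Lorentzian.E4), 0 < ε N mass spin motion) ∧ ∀ (X : Type) [TopologicalSpace X]
[ChartedSpace Literature.Geometry.Lorentzian.E3 X] [IsManifold (𝓡 3) ((⊤ : ℕ∞) : WithTop ℕ∞) X]
[T2Space X] [SecondCountableTopology X] [ConnectedSpace X] (D :
Literature.Geometry.Lorentzian.InitialDataSet (𝓡 3) X), D ∈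
Literature.Geometry.Lorentzian.admissibleVacuumData X → ∀ 𝒟 :
Literature.Geometry.Lorentzian.VacuumCauchyDevelopment D, 𝒟.IsMaximal →
Summit.FinalStateConjecture.HasCompleteNullInfinity 𝒟.toCauchyDevelopment → (∃ (N : ℕ) (mass spin :
Fin N → ℝ) (motion : Fin N → ↥Literature.Geometry.Lorentzian.lorentzGroup ×
Literature.Geometry.Lorentzian.E4) (τ₀ : ℝ) (chart : ∀ i : Fin N,
↥(Literature.Geometry.Lorentzian.boostedKerrExterior (motion i).1 (motion i).2 (mass i) (spin i)) →
𝒟.carrier) (Rnz excision : Fin N → ℝ → ℝ) (U₀ : TopologicalSpace.Opens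
Literature.Geometry.Lorentzian.E4) (flatChart : ↥U₀ → 𝒟.carrier), let bg : Fin N →
Literature.Geometry.Lorentzian.ModelBackground := fun i ↦
Literature.Geometry.Lorentzian.boostedKerrBackground (motion i).1 (motion i).2 (mass i) (spin i);
let fl : Literature.Geometry.Lorentzian.ModelBackground :=
Literature.Geometry.Lorentzian.Minkowski.backgroundOn U₀; let O : Set 𝒟.carrier :=
Summit.FinalStateConjecture.exteriorOf 𝒟.toCauchyDevelopment ((⋃ i, chart i '' (bg i).lateRegion τ₀)
∪ flatChart '' fl.lateRegion τ₀); (∀ i, Literature.Geometry.Lorentzian.Kerr.IsSubextremal (mass i)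
(spin i)) ∧ (∀ i, 𝒟.toSpacetime.IsLateChart (bg i) O τ₀ (chart i)) ∧ 𝒟.toSpacetime.IsLateChart fl O
τ₀ flatChart ∧ (∀ i, Filter.Tendsto (Rnz i) Filter.atTop Filter.atTop) ∧ (∀ i (τ : ℝ), τ₀ ≤ τ →
𝒟.toSpacetime.truncDeviationCk (bg i) (chart i) k (Rnz i τ) τ ≤ ε N mass spin motion) ∧ (∀ τ : ℝ, τ₀
≤ τ → 𝒟.toSpacetime.deviationCk fl flatChart k τ ≤ ε N mass spin motion) ∧ (∀ ρ : ℝ, ∃ τ₁ : ℝ,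
Pairwise (Function.onFun Disjoint fun i ↦ chart i '' (bg i).truncLateRegion τ₁ ρ)) ∧ (∀ i,
Filter.Tendsto (fun t ↦ excision i t / t) Filter.atTop (nhds 0)) ∧ ({x :
Literature.Geometry.Lorentzian.E4 | τ₀ < x 0 ∧ ∀ i, excision i (x 0) <
Literature.Geometry.Lorentzian.Kerr.radius (spin i) (Literature.Geometry.Lorentzian.poincareInv
(motion i).1 (motion i).2 x)} ⊆ (U₀ : Set Literature.Geometry.Lorentzian.E4)) ∧ (∀ τ₁ : ℝ, τ₀ < τ₁ →
O \ (flatChart '' fl.lateRegion τ₁ ∪ ⋃ i, chart i '' {x | τ₁ < (bg i).time x.1 ∧ (bg i).radius x.1 ≤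
Rnz i ((bg i).time x.1)}) ⊆ 𝒟.toSpacetime.metric.causalPast 𝒟.toSpacetime.timeOrientation (flatChart
'' fl.timeSlab τ₁ ∪ ⋃ i, chart i '' (bg i).truncTimeSlab (Rnz i τ₁) τ₁))) → (∃ (O : Set 𝒟.carrier)
(d : Literature.Geometry.Lorentzian.FinalStateDecomposition 𝒟.toSpacetime O 2), (∀ i,
Literature.Geometry.Lorentzian.Kerr.IsSubextremal (d.mass i) (d.spin i)) ∧ O =
Summit.FinalStateConjecture.exteriorOf 𝒟.toCauchyDevelopment d.charted ∧
Summit.FinalStateConjecture.HasExhaustiveCharts d)`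

## Assembly
Pure logic, proved in Sketch.lean as `closes` (axioms: propext, Classical.choice, Quot.sound): take
(k, ε) from MultiKerrBasin; GenericShadowing
at that (k, ε) gives, for each X, codimension-1 genericity of P_orb = (∃ MGHD) ∧ ∀ MGHD (complete 𝓘⁺
∧ ε-shadow); MultiKerrBasin upgrades P_orb
pointwise on admissibleVacuumData X to the Statement's property P_fsc; Christodoulou genericity is
monotone under pointwise implication on the
admissible class (the one-parameter family through an exceptional datum of P_fsc is exceptional for
P_orb only at 0), whence
FinalStateConjecture. RecedingSKSDecay and StaticSKSDecay are hypotheses of `closes` that the logic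
does not consume: they are the model
theorems whose proofs ARE the mechanism MultiKerrBasin needs (Two-layer plan), ranked first so that
the line is tested where it is new.

Rationale: WHY THIS LINE. The N ≥ 2 endgame of the conjecture is linearisation around finitely many far-apart
Kerr exteriors moving apart; its trapped null-geodesic set is
(N normally hyperbolic photon shells) ∪ (a hyperbolic Cantor repeller of inter-hole bouncing orbits,
ShipleyDolan2016, AssumpcaoEtAl2018,
BernardEtAl2019) ∪ heteroclinics, and no decay theorem exists on any multi-centre black-hole
background (zbMATH/galaxy searches below; the
nbody-asymptotic-completeness card records the repeller as an unproved bet). Imported from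
semiclassical scattering: resonance gaps for hyperbolic
trapped sets (Ikawa1988, NonnenmacherZworski2007, WunschZworski2011) and the pressure-free gap of
the fractal uncertainty principle
(BourgainDyatlov2018, Vacossin2024 Thm 1) for the per-azimuthal-mode repeller; gluing of resolvent
estimates (DatchevVasy2012); from hyperbolic
PDE: local energy decay on time-dependent backgrounds (MetcalfeSterbenzTataru2017,
MetcalfeTataruTohaneanu2011, LindbladTohaneanu2016) and the
black-box use of integrated decay in quasilinear problems (DafermosEtAl2026). Two observations shape
the route: (i) the summit only needs the
regime D ≫ M (holes recede), where the repeller's expansion per bounce ≍ (D/M)² beats its bounded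
entropy, so Ikawa's pressure condition holds
with room to spare and FUP is robustness (no tuned constant, uniformity down to moderate D), not a
load-bearing miracle; (ii) the non-stationarity
of a receding configuration is INTEGRABLE in time (∂ₜg = O(Mv/D(t)²), ∫ dt < ∞), so uniform
boundedness plus integrated decay with one lost
derivative is the natural conjecture (adiabatic decoupling; receding mirrors only red-shift). The
nonlinear frame is the attractor dichotomy
"ω-limit shadowing (GenericShadowing) + basin (MultiKerrBasin)", with the basin stated pointwise in
the datum so that the assembly never
intersects two Christodoulou-generic sets (the trap recorded by card
genericity-is-not-closed-under-and); the ∃(k,ε)/∀(k,ε) handshake makes the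
composition pure logic (closes, proved in Sketch.lean). No prior route exists on this summit;
negatives index empty.

RANKED CRUXES. #0 MultiKerrBasin (target) — RECEDING MULTI-KERR IS A BASIN (orbital ⇒ asymptotic
stability, pointwise in the datum). ∃ k ∈ ℕ and a tolerance ε(N, mass, spin, motion) > 0
(ℝ≥0∞-valued) such that for every 3-manifold X, every D ∈ admissibleVacuumData X, every maximal
VacuumCauchyDevelopment 𝒟 of D with HasCompleteNullInfinity: if 𝒟 carries an ε-shadow — N,
sub-extremal (Mᵢ, aᵢ), motions (Λᵢ, cᵢ), τ₀, hole charts Ψᵢ on the boosted Kerr exteriors and a flat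
chart Ψ₀ on U₀ ⊇ {x⁰ > τ₀} minus sublinear tubes, all IsLateChart into O := exteriorOf(charted
images), near-zone radii Rᵢ(τ) → ∞ with truncDeviationCk ≤ ε on {t*ᵢ = τ, rᵢ ≤ Rᵢ(τ)} and
deviationCk(flat) ≤ ε for all τ ≥ τ₀, near zones eventually pairwise disjoint for every radius, and
for every τ₁ > τ₀ the exhaustive covering O ∖ certifiedLate(τ₁) ⊆ J⁻(certifiedSlab(τ₁)) (bodies of
the Statement's certifiedLate/certifiedSlab inlined) — then ∃ O, d : FinalStateDecomposition
𝒟.toSpacetime O 2 with sub-extremal holes, O = exteriorOf 𝒟 d.charted and HasExhaustiveCharts d. For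
N = 0 this is "orbitally Minkowskian forever ⇒ disperses", for N = 1 "orbitally Kerr forever ⇒
converges to a nearby Kerr" (open for |a| < M not small), for N ≥ 2 the receding endgame proper.
(why it might fail: Unweighted Cᵏ sup-norm shadowing carries no r-weights, so the r^p/vector-field
method has no small weighted energy to start from; N ≥ 2 also needs full sub-extremal Kerr linear
theory (only |a| ≪ M known, arXiv:2205.14808) and modulation with inter-hole momentum exchange.)
[GiorgiKlainermanSzeftel2022, KlainermanSzeftel2023, DafermosHolzegelRodnianskiTaylor2021,
DafermosRodnianskiShlapentokhrothman2014, DafermosLuk2017, AnderssonBlue2015]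
#2 RecedingSKSDecay (crux) — UNIFORM DECAY ON RECEDING TWO-HOLE BACKGROUNDS (card K2, scalar model,
a = 0 first). Fix M₁, M₂ > 0, a recession rate v > 0, orthochronous Lorentz motions Λ₁, Λ₂ and a
smooth cutoff χ (χ = 1 on (−∞, 1/3], χ = 0 on [1/2, ∞)). Then ∃ D₀, C > 0 such that for all
translations c₁, c₂ with rest-frame radii satisfying r₁(x) + r₂(x) ≥ D₀ + v·x⁰ for x⁰ ≥ 0 (the holes
recede at rate ≥ v from separation ≥ D₀), on the superposed Kerr–Schild background g = η + (1 −
χ(r₂/D₀))(KS₁ − η) + (1 − χ(r₁/D₀))(KS₂ − η) (KSᵢ = boostedKerrBilin Λᵢ cᵢ Mᵢ 0: each hole EXACTLY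
boosted Schwarzschild within rest-frame distance D₀/3, full superposition beyond D₀/2;
MatznerHuqShoemaker1998) on U = {x⁰ > −(M₁+M₂), r₁ > 3M₁/2, r₂ > 3M₂/2} (excision inside the
horizons, exit boundary spacelike), every smooth ψ with □_g ψ = 0 on {x⁰ > 0} and compactly
supported Cauchy data on {x⁰ = 0} obeys (a) uniform energy boundedness sliceEnergy(τ) ≤ C·E₁ for all
τ ≥ 0 and (b) integrated local energy decay ∫₀^∞ localSliceEnergy(τ, R) dτ ≤ C·R·E₁ for every R ≥
D₀, where E₁ = sliceEnergy(ψ, 0) + (M₁+M₂)² Σ_μ sliceEnergy(∂_μ ψ, 0) (one derivative lost;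
constants uniform in time and in the translations, i.e. in the actual separation history).
[difficulty: XL] (why it might fail: No commutator construction exists for TIME-DEPENDENT trapping
(arXiv:1703.08064 is non-trapping, arXiv:1610.00674 perturbs one stationary trapped set);
frequencies ω ≲ 1/D(t) resolve neither hole, and moving O(M/D₀) ramps may pump energy if ∫|∂ₜg|dt ≲
M/D₀ fails near the repeller.) [MetcalfeSterbenzTataru2017, LindbladTohaneanu2016,
MetcalfeTataruTohaneanu2011, Ikawa1988, DatchevVasy2012, MatznerHuqShoemaker1998, arXiv:0811.0354]
#3 StaticSKSDecay (crux) — INTEGRATED DECAY ON STATIC TWO-HOLE BACKGROUNDS, UNIFORMLY IN THE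
SEPARATION (card K1+K3 in the regime the summit needs). For M₁, M₂ > 0 and a smooth cutoff χ as
above ∃ D₀, C > 0 such that for every separation D ≥ D₀, on the static superposed Kerr–Schild
background with Schwarzschild holes at ±(D/2)e₃, g = η + (1 − χ(r₂/D))(KS₁ − η) + (1 − χ(r₁/D))(KS₂
− η) (exact Schwarzschild(Mᵢ) within D/3 of each hole: red-shift at a true Killing horizon and an
exact photon sphere; asymptotically Schwarzschild of mass M₁+M₂), on U = {r₁ > 3M₁/2, r₂ > 3M₂/2},
every smooth solution of □_g ψ = 0 on {x⁰ > 0} with compactly supported data satisfies ∫₀^∞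
localSliceEnergy(τ, 2D) dτ ≤ C·D·E₁, E₁ as in RecedingSKSDecay. Content: one resolvent/ILED bound
gluing two normally hyperbolic photon spheres, the hyperbolic inter-hole repeller and the
heteroclinic orbits joining them, with the inter-hole loss costing no more than the free dwell time
≍ D (engine: Ikawa/Nonnenmacher–Zworski gap, P(1/2) < 0 automatic for D ≫ M; or Vacossin's FUP gap
per azimuthal mode m after reduction by the axial Killing field, |m| ≫ 1 being non-trapped between
the holes). [difficulty: L] (why it might fail: Shells + repeller + heteroclinics is neither
normally nor uniformly hyperbolic as a whole; Datchev–Vasy gluing wants a convex separation the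
heteroclinics obstruct; the D-linear constant must survive ω ~ 1/D; at D ~ M stable photon orbits
exist (arXiv:1605.07193), so D₀ is essential.) [WunschZworski2011, NonnenmacherZworski2007,
Ikawa1988, Vacossin2024, BourgainDyatlov2018, DyatlovJinNonnenmacher2021, DatchevVasy2012,
ShipleyDolan2016, DolanShipley2016, Sbierski2015, TataruTohaneanu2010]
#4 GenericShadowing (crux) — GENERIC DATA SHADOW A RECEDING MULTI-KERR CONFIGURATION (the
complementary half: censorship + no other attractor, in orbital form). For every k and every
positive tolerance ε(N, mass, spin, motion), the property "D has a maximal VacuumCauchyDevelopment,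
and every maximal one has complete 𝓘⁺ (HasCompleteNullInfinity) and carries an ε-shadow in Cᵏ
(verbatim the hypothesis of MultiKerrBasin)" is Christodoulou-generic with codimension 1 in
admissibleVacuumData X, for every admissible 3-manifold X. It contains weak cosmic censorship, MGHD
existence in the typed setting, finiteness of N, sub-extremality of the limiting holes and
recession; it asserts closeness but no rate, and it is implied by the Statement only for k = 2.
[difficulty: open-problem] (why it might fail: It is the conjecture minus rates: weak censorship, no
eternal non-Kerr breathers, no infinite merger cascade, generic sub-extremality all sit inside; for
k > 2 it exceeds the C² Statement; curve-genericity of so composite a property may fail even where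
each part is generic.) [Christodoulou1999, DafermosLuk2017, Christodoulou2008, Klainerman2025,
Penrose1982, arXiv:2601.01517]

TWO-LAYER PLAN. MultiKerrBasin ⇐ (B1) LINEARISED DECAY ON SHADOWED BACKGROUNDS: uniform boundedness
+ integrated decay with finite loss for the linearised
Einstein equations (Teukolsky/generalised Regge–Wheeler system, needs the prelude's missing
spin-weighted operator, gr.S27) on every background
that ε-shadows N receding sub-extremal Kerrs — the tensorial, a ≠ 0 version of RecedingSKSDecay,
whose inter-hole part is StaticSKSDecay frozen
at separation D(t) plus the adiabatic error; (B2) MODULATION: final parameters (Mᵢ, aᵢ, Λᵢ, cᵢ)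
exist because inter-hole momentum/energy exchange
is O(M²/D(t)²), integrable; (B3) INTEGRATION TO CHARTS: decay of the linearised quantities in the
shadow gauge ⇒ C² convergence on near zones out
to Rᵢ(τ) and on flat slabs, exhaustive covering inherited from the hypothesis → MultiKerrBasin.
RecedingSKSDecay ⇐ (R1) StaticSKSDecay-type
high-frequency estimate frozen at each time + (R2) a large-scale (|ξ| ≲ 1/D) two-centre Morawetz
estimate + (R3) adiabatic gluing in time using
∫₀^∞ ‖∂ₜg‖ dt ≲ M/D₀. GenericShadowing is not split here (it belongs to the capture/censorship
cards: dissipation-budget-quiet-window-capture,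
settling-certifies-censorship, third-law-transversality-injection); if one of those opens a route
its items are shared, not re-filed.

KILL CRITERIA. Refutation of StaticSKSDecay by a sequence of separations Dₙ → ∞ with unbounded
normalised ILED constant (e.g. a low-frequency or heteroclinic
resonance approaching the real axis faster than 1/Dₙ) closes the route outright (close --reason
refuted:StaticSKSDecay): the inter-hole trapping
would then NOT be transient and the whole "dissolving repeller" picture is wrong. Refutation of
RecedingSKSDecay with StaticSKSDecay intact forces a
pivot to a loss-in-time statement (energy growth ≤ C log t or t^δ) and re-examination of (B1). A
refutation of GenericShadowing at k = 2 refutes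
the Statement itself (it is implied by it at k = 2); at k > 2 only it forces k = 2 in
MultiKerrBasin. A proof elsewhere of full sub-extremal Kerr
stability does NOT moot the route (N ≥ 2 remains); an N ≥ 2 route through backwards scattering
(receding-kerrs-exist-mixed-scattering) constructs
examples but not the open basin, so it does not supersede either.

NOT DECOMPOSED YET. Kerr (aᵢ ≠ 0) and tensorial versions of the two linear cruxes; the quantitative
dissolution law E(t) ≲ E₀ exp(−c log²(t/t₀)) for energy
microlocalised near the repeller (card Claim 2) and the superradiance-vs-dilution inequality (1 +
Z_max)·c·(M/D)² < 1 (card Claim 3) — both are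
layer-2 children of RecedingSKSDecay once a ≠ 0 enters; the pressure census P(1/2)(D/M) of the
repeller (card P1, a kit computation); weighted
(r^p) upgrades of the shadow hypothesis; the low-frequency two-centre Morawetz estimate (R2).
Constants D₀, C are existential on purpose.

CHEAPEST FALSIFIER. A 1+1-dimensional toy of RecedingSKSDecay (card P3): two
Pöschl–Teller/Regge–Wheeler barriers receding at speed v, data trapped between them;
compute sup_t E(t)/E₁ and ∫E_loc over a range of (D₀, v, frequency). Growth of the bounded-energy
constant with the initial frequency beyond the
one-derivative allowance, or an ILED constant growing faster than linearly in R, kills the crux as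
typed. Not run here (hub is compute-free and
this seat is one-shot); it is the first job for whoever takes rank 2. Second cheapest: the
null-geodesic pressure census P(1/2) versus D/M for
the static SKS pair (card P1) — if P(1/2) ≥ 0 persisted to D/M → ∞ the D-uniformity in
StaticSKSDecay would be implausible (expected:
P(1/2) ≈ (h_top − log(D/M))/D < 0 beyond a fixed multiple of M).

NUMBERS. Photon sphere r = 3M, horizon r₊ = 2M (a = 0); excision at 3M/2 (spacelike exit boundary,
g⁻¹(dr,dr) = 1 − 2M/r = −1/3 there). Near-zone
exactness radius D/3 resp. D₀/3; ramps on [D/3, D/2]. Repeller: unstable Jacobian per inter-hole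
passage ≍ (D/M)², flight time ≍ D, so
Lyapunov exponent per unit time ≍ 2 log(D/M)/D and topological pressure P(1/2) ≈ (h_top −
log(D/M))/D per unit time with h_top = O(1)
independent of D (finitely many transfer channels per bounce, higher windings exponentially
suppressed; ShipleyDolan2016) — negative once
log(D/M) > h_top, i.e. beyond a fixed multiple of M. Maximal superradiant amplification Z_max ≈ 1.38
(gravitational, Teukolsky–Press 1974; BardeenPressTeukolsky1972) enters only at a ≠ 0. Stable photon
orbits of MP di-holes occur only at
separations comparable to M (DolanShipley2016), hence D₀.

DEFINITION REQUESTS. None blocking: every item elaborates over the prelude (Sketch.lean rc 0).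
Wanted later (layer 2, not filed now): the spin-weighted Teukolsky
operator on Kerr–Schild charts (gr.S27, flagged missing in
Literature.Geometry.Lorentzian.BlackHoles) for (B1); a Literature home
`Literature/Analysis/Microlocal` for `EssentialSpectralGap`/cut-off resolvent bounds if a prover
prefers the resolvent form of StaticSKSDecay.

Novelty: Searches (2026-08-15): `lit galaxy search "superposed Kerr-Schild" --star all` (3 pdf hits, all
numerical-relativity initial data: Lovelace-type SKS/SHK data; no wave decay); `lit galaxy search
"waves reflecting off a moving obstacle" --star all` (Tamura 1978, Roach's monograph, Cooper–Strauss
line: NON-trapping moving obstacles); `lit galaxy search "two convex obstacles" --star pdf` (12: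
Vacossin2024, fractal Weyl bounds, Ikawa-type — all stationary obstacles); `lit search --source
zbmath "wave equation decay several black holes"` (5: Aretakis ERN, DR red-shift — single hole),
`"Majumdar-Papapetrou wave equation"` (3: Aretakis horizon instability; no decay theorem), `"local
energy decay moving obstacles trapping"` (2: Petkov–Georgiev 1989 RAGE for periodically moving
non-trapping obstacles, Petkov 2006); `lit frontier FinalStateConjecture --since 2020` (30 rows;
relevant: arXiv:2601.01517 multi-black-hole Cauchy data, arXiv:2212.14093 = DafermosEtAl2026
quasilinear waves on Kerr); plus the card's own battery (galaxy "fractal uncertainty principle",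
"Majumdar-Papapetrou", "Vacossin"; arXiv queries on binary shadows/di-hole scattering) and the
refuter's (BernardEtAl2019). searchd (local index), OpenAlex, Semantic Scholar and arXiv API were
unavailable this session (rc 75 / HTTP 429).
Nearest prior art found: Ikawa1988 and NonnenmacherZworski2007/WunschZworski2011 (gaps for
hyperbolic / normally hyperbolic trapping, stationary); Vacossin2024 Thm 1 and BourgainDyatlov2018
(press  [refs: 2601.01517, 2212.14093, Vacossin2024, DafermosEtAl2026, BernardEtAl2019, Ikawa1988, NonnenmacherZworski2007, WunschZworski2011, BourgainDyatlov2018, MetcalfeSterbenzTataru2017, LindbladTohaneanu2016, ShipleyDolan2016, AssumpcaoEtAl2018, MatznerHuqShoemaker1998]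

Barriers (technique_class: microlocal-resolvent, non-autonomous-trapping, FUP): - technique_class: microlocal-resolvent, non-autonomous-trapping, fractal-uncertainty,
orbital-to-asymptotic-stability
- Literature.Barriers.FinalStateConjecture.SbierskiTrappingObstruction: conceded and built in — both
linear cruxes lose one full derivative (E₁ carries sliceEnergy of ∂ψ); Gaussian beams on the photon
spheres or on the repeller are exactly what the loss pays for.
- Literature.Barriers.FinalStateConjecture.KerrSuperradiance: absent from the a = 0 model cruxes
(each near zone is exact Schwarzschild with Killing horizon, no ergoregion — the cutoff χ is there
precisely so that no spurious thin ergo-shell of the raw superposition arises); at a ≠ 0 it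
re-enters only through the imported single-hole theory and the dilution inequality (layer 2).
- Literature.Barriers.FinalStateConjecture.AretakisInstability: evaded by model choice —
sub-extremal (Schwarzschild) holes with excision inside the horizon instead of the extremal
Majumdar–Papapetrou di-hole; MultiKerrBasin and the shadow demand |aᵢ| < Mᵢ strictly with tolerance
allowed to shrink near extremality.
- Literature.Barriers.FinalStateConjecture.PriceLawTail: consistent — only INTEGRATED local energy
decay and boundedness are claimed (polynomial tails are integrable); no exponential or uniform-rate
LED is asserted anywhere.
- Literature.Barriers.FinalStateConjecture.SlowlyRotatingKerrFrontier: not evaded — MultiKerrBasin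
for N = 1, |a| not small, contains the frontier; the bet is that the route's new content (N ≥

sub-problem: FinalStateConjecture · status: open · opened planner-plancard-FinalStateConjecture-FinalSt-48df0a02-0 2026-08-15T15:06:46Z · rev 2 · ledger route-FinalStateConjecture-RecedingRepeller
GENERATED by the gate from the ledger (D-0016/17). Provers cite these decls: `theorem foo : Summit.FinalStateConjecture.FinalStateConjecture.Theses.RecedingRepeller.<Decl> := …` in Summits/FinalStateConjecture/FinalStateConjecture/Theorems/<Name>.lean.
-/

namespace Summit.FinalStateConjecture.FinalStateConjecture.Theses.RecedingRepeller

open scoped BigOperators Topology Manifold Classical MeasureTheory ProbabilityTheory Matrix InnerProductSpace ComplexConjugate ContinuousMap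
open Filter Set Function TopologicalSpace MeasureTheory

attribute [summit_statement] _root_.FinalStateConjecture

/-- item stmt-FinalStateConjecture-10081 · target · rank 0 · open · by planner
why it might fail: Large data, only unweighted Cᵏ sup-norm shadowing: no r-weights, so r^p/vector-field methods lack a small weighted energy; N = 1 contains orbital⇒asymptotic Kerr stability for all |a| < M (nonlinear only |a| ≪ M, KlainermanSzeftel2023; linear arXiv:2302.08916); N ≥ 2 adds modulation.
sources: GiorgiKlainermanSzeftel2022, KlainermanSzeftel2023, ShlapentokhrothmanCosta2023, DafermosHolzegelRodnianskiTaylor2021, DafermosRodnianskiShlapentokhrothman2014, DafermosLuk2017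
[target] RECEDING MULTI-KERR IS A BASIN (orbital ⇒ asymptotic stability, pointwise in the datum). ∃
k ∈ ℕ and a tolerance ε(N, mass, spin, motion) > 0 (ℝ≥0∞-valued) such that for every 3-manifold X,
every D ∈ admissibleVacuumData X, every maximal VacuumCauchyDevelopment 𝒟 of D with
HasCompleteNullInfinity: if 𝒟 carries an ε-shadow — N, sub-extremal (Mᵢ, aᵢ), motions (Λᵢ, cᵢ), τ₀,
hole charts Ψᵢ on the boosted Kerr exteriors and a flat chart Ψ₀ on U₀ ⊇ {x⁰ > τ₀} minus sublinear
tubes, all IsLateChart into O := exteriorOf(charted images), near-zone radii Rᵢ(τ) → ∞ with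
truncDeviationCk ≤ ε on {t*ᵢ = τ, rᵢ ≤ Rᵢ(τ)} and deviationCk(flat) ≤ ε for all τ ≥ τ₀, near zones
eventually pairwise disjoint for every radius, and for every τ₁ > τ₀ the exhaustive covering O ∖
certifiedLate(τ₁) ⊆ J⁻(certifiedSlab(τ₁)) (bodies of the Statement's certifiedLate/certifiedSlab
inlined) — then ∃ O, d : FinalStateDecomposition 𝒟.toSpacetime O 2 with sub-extremal holes, O =
exteriorOf 𝒟 d.charted and HasExhaustiveCharts d. For N = 0 this is "orbitally Minkowskian forever ⇒
disperses", for N = 1 "orbitally Kerr forever ⇒ converges to a nearby Kerr" (open for |a| < M not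
small), for N ≥ 2 the receding endgame -/
@[route_item "route-FinalStateConjecture-RecedingRepeller", crux]
def MultiKerrBasin : Prop :=
  ∃ (k : ℕ) (ε : (N : ℕ) → (Fin N → ℝ) → (Fin N → ℝ) → (Fin N → ↥Literature.Geometry.Lorentzian.lorentzGroup × Literature.Geometry.Lorentzian.E4) → ENNReal), (∀ (N : ℕ) (mass spin : Fin N → ℝ) (motion : Fin N → ↥Literature.Geometry.Lorentzian.lorentzGroup × Literature.Geometry.Lorentzian.E4), 0 < ε N mass spin motion) ∧ ∀ (X : Type) [TopologicalSpace X] [ChartedSpace Literature.Geometry.Lorentzian.E3 X] [IsManifold (𝓡 3) ((⊤ : ℕ∞) : WithTop ℕ∞) X] [T2Space X] [SecondCountableTopology X] [ConnectedSpace X] (D : Literature.Geometry.Lorentzian.InitialDataSet (𝓡 3) X), D ∈ Literature.Geometry.Lorentzian.admissibleVacuumData X → ∀ 𝒟 : Literature.Geometry.Lorentzian.VacuumCauchyDevelopment D, 𝒟.IsMaximal → Summit.FinalStateConjecture.HasCompleteNullInfinity 𝒟.toCauchyDevelopment → (∃ (N : ℕ) (mass spin : Fin N → ℝ) (motion : Fin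 N → ↥Literature.Geometry.Lorentzian.lorentzGroup × Literature.Geometry.Lorentzian.E4) (τ₀ : ℝ) (chart : ∀ i : Fin N, ↥(Literature.Geometry.Lorentzian.boostedKerrExterior (motion i).1 (motion i).2 (mass i) (spin i)) → 𝒟.carrier) (Rnz excision : Fin N → ℝ → ℝ) (U₀ : TopologicalSpace.Opens Literature.Geometry.Lorentzian.E4) (flatChart : ↥U₀ → 𝒟.carrier), let bg : Fin N → Literature.Geometry.Lorentzian.ModelBackground := fun i ↦ Literature.Geometry.Lorentzian.boostedKerrBackground (motion i).1 (motion i).2 (mass i) (spin i); let fl : Literature.Geometry.Lorentzian.ModelBackground := Literature.Geometry.Lorentzian.Minkowski.backgroundOn U₀; let O : Set 𝒟.carrier := Summit.FinalStateConjecture.exteriorOf 𝒟.toCauchyDevelopment ((⋃ i, chart i '' (bg i).lateRegion τ₀) ∪ flatChart '' fl.lateRegion τ₀); (∀ i, Literature.Geometry.Lorentzian.Kerr.IsSubextremal (mass i) (spin i)) ∧ (∀ i, 𝒟.toSpacetime.IsLateChart (bg i) O τ₀ (chart i)) ∧ 𝒟.toSpacetime.IsLateChart fl O τ₀ flatChart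 ∧ (∀ i, Filter.Tendsto (Rnz i) Filter.atTop Filter.atTop) ∧ (∀ i (τ : ℝ), τ₀ ≤ τ → 𝒟.toSpacetime.truncDeviationCk (bg i) (chart i) k (Rnz i τ) τ ≤ ε N mass spin motion) ∧ (∀ τ : ℝ, τ₀ ≤ τ → 𝒟.toSpacetime.deviationCk fl flatChart k τ ≤ ε N mass spin motion) ∧ (∀ ρ : ℝ, ∃ τ₁ : ℝ, Pairwise (Function.onFun Disjoint fun i ↦ chart i '' (bg i).truncLateRegion τ₁ ρ)) ∧ (∀ i, Filter.Tendsto (fun t ↦ excision i t / t) Filter.atTop (nhds 0)) ∧ ({x : Literature.Geometry.Lorentzian.E4 | τ₀ < x 0 ∧ ∀ i, excision i (x 0) < Literature.Geometry.Lorentzian.Kerr.radius (spin i) (Literature.Geometry.Lorentzian.poincareInv (motion i).1 (motion i).2 x)} ⊆ (U₀ : Set Literature.Geometry.Lorentzian.E4)) ∧ (∀ τ₁ : ℝ, τ₀ < τ₁ → O \ (flatChart '' fl.lateRegion τ₁ ∪ ⋃ i, chart i '' {x | τ₁ < (bg i).time x.1 ∧ (bg i).radius x.1 ≤ Rnz i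 ((bg i).time x.1)}) ⊆ 𝒟.toSpacetime.metric.causalPast 𝒟.toSpacetime.timeOrientation (flatChart '' fl.timeSlab τ₁ ∪ ⋃ i, chart i '' (bg i).truncTimeSlab (Rnz i τ₁) τ₁))) → (∃ (O : Set 𝒟.carrier) (d : Literature.Geometry.Lorentzian.FinalStateDecomposition 𝒟.toSpacetime O 2), (∀ i, Literature.Geometry.Lorentzian.Kerr.IsSubextremal (d.mass i) (d.spin i)) ∧ O = Summit.FinalStateConjecture.exteriorOf 𝒟.toCauchyDevelopment d.charted ∧ Summit.FinalStateConjecture.HasExhaustiveCharts d)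

/-- item stmt-FinalStateConjecture-10082 · crux · rank 2 · open · by planner
why it might fail: No theory for MOVING trapping: arXiv:1703.08064 is non-trapping, arXiv:1610.00674 perturbs one stationary trapped set, arXiv:2408.06712 is uniform only on compact time ranges; two rest frames ⇒ no global almost-Killing field (patching bulk O(v)·E₁, no sign); moving scatterers can pump energy.
sources: MetcalfeSterbenzTataru2017, LindbladTohaneanu2016, arXiv:2408.06712, MetcalfeTataruTohaneanu2011, doi:10.1512/iumj.1976.25.25052, zbl:0707.35084
[crux] UNIFORM DECAY ON RECEDING TWO-HOLE BACKGROUNDS (card K2, scalar model, a = 0 first). Fix M₁,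
M₂ > 0, a recession rate v > 0, orthochronous Lorentz motions Λ₁, Λ₂ and a smooth cutoff χ (χ = 1 on
(−∞, 1/3], χ = 0 on [1/2, ∞)). Then ∃ D₀, C > 0 such that for all translations c₁, c₂ with
rest-frame radii satisfying r₁(x) + r₂(x) ≥ D₀ + v·x⁰ for x⁰ ≥ 0 (the holes recede at rate ≥ v from
separation ≥ D₀), on the superposed Kerr–Schild background g = η + (1 − χ(r₂/D₀))(KS₁ − η) + (1 −
χ(r₁/D₀))(KS₂ − η) (KSᵢ = boostedKerrBilin Λᵢ cᵢ Mᵢ 0: each hole EXACTLY boosted Schwarzschild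
within rest-frame distance D₀/3, full superposition beyond D₀/2; MatznerHuqShoemaker1998) on U = {x⁰
> −(M₁+M₂), r₁ > 3M₁/2, r₂ > 3M₂/2} (excision inside the horizons, exit boundary spacelike), every
smooth ψ with □_g ψ = 0 on {x⁰ > 0} and compactly supported Cauchy data on {x⁰ = 0} obeys (a)
uniform energy boundedness sliceEnergy(τ) ≤ C·E₁ for all τ ≥ 0 and (b) integrated local energy decay
∫₀^∞ localSliceEnergy(τ, R) dτ ≤ C·R·E₁ for every R ≥ D₀, where E₁ = sliceEnergy(ψ, 0) + (M₁+M₂)²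
Σ_μ sliceEnergy(∂_μ ψ, 0) (one derivative lost; constants uniform in time and in the translations,
i.e. in the actual sepa -/
@[route_item "route-FinalStateConjecture-RecedingRepeller", crux]
def RecedingSKSDecay : Prop :=
  ∀ (M₁ M₂ v : ℝ), 0 < M₁ → 0 < M₂ → 0 < v → ∀ (Λ₁ Λ₂ : ↥Literature.Geometry.Lorentzian.lorentzGroup), 0 < (Λ₁ : Literature.Geometry.Lorentzian.E4 ≃L[ℝ] Literature.Geometry.Lorentzian.E4) (EuclideanSpace.single (0 : Fin 4) (1 : ℝ)) 0 → 0 < (Λ₂ : Literature.Geometry.Lorentzian.E4 ≃L[ℝ] Literature.Geometry.Lorentzian.E4) (EuclideanSpace.single (0 : Fin 4) (1 : ℝ)) 0 → ∀ (χ : ℝ → ℝ), ContDiff ℝ ((⊤ : ℕ∞) : WithTop ℕ∞) χ → (∀ s : ℝ, s ≤ 1 / 3 → χ s = 1) → (∀ s : ℝ, 1 / 2 ≤ s → χ s = 0) → ∃ (D₀ C : ℝ), 0 < D₀ ∧ 0 < C ∧ ∀ (c₁ c₂ : Literature.Geometry.Lorentzian.E4), (∀ x : Literature.Geometry.Lorentzian.E4,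 0 ≤ x 0 → D₀ + v * x 0 ≤ Literature.Geometry.Lorentzian.Kerr.radius 0 (Literature.Geometry.Lorentzian.poincareInv Λ₁ c₁ x) + Literature.Geometry.Lorentzian.Kerr.radius 0 (Literature.Geometry.Lorentzian.poincareInv Λ₂ c₂ x)) → ∀ (U : TopologicalSpace.Opens Literature.Geometry.Lorentzian.E4), (U : Set Literature.Geometry.Lorentzian.E4) = {x | -(M₁ + M₂) < x 0 ∧ 3 * M₁ / 2 < Literature.Geometry.Lorentzian.Kerr.radius 0 (Literature.Geometry.Lorentzian.poincareInv Λ₁ c₁ x) ∧ 3 * M₂ / 2 < Literature.Geometry.Lorentzian.Kerr.radius 0 (Literature.Geometry.Lorentzian.poincareInv Λ₂ c₂ x)} → ∀ (g : Literature.Geometry.Lorentzian.LorentzianMetric (modelWithCornersSelf ℝ Literature.Geometry.Lorentzian.E4) ((⊤ : ℕ∞) : WithTop ℕ∞) ↥U), (∀ (x : ↥U) (w₁ w₂ : Literature.Geometry.Lorentzian.E4), g.val x w₁ w₂ = Literature.Geometry.Lorentzian.Minkowski.bilin w₁ w₂ + (1 - χ (Literature.Geometry.Lorentzian.Kerr.radius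 0 (Literature.Geometry.Lorentzian.poincareInv Λ₂ c₂ (x : Literature.Geometry.Lorentzian.E4)) / D₀)) * (Literature.Geometry.Lorentzian.boostedKerrBilin Λ₁ c₁ M₁ 0 (x : Literature.Geometry.Lorentzian.E4) w₁ w₂ - Literature.Geometry.Lorentzian.Minkowski.bilin w₁ w₂) + (1 - χ (Literature.Geometry.Lorentzian.Kerr.radius 0 (Literature.Geometry.Lorentzian.poincareInv Λ₁ c₁ (x : Literature.Geometry.Lorentzian.E4)) / D₀)) * (Literature.Geometry.Lorentzian.boostedKerrBilin Λ₂ c₂ M₂ 0 (x : Literature.Geometry.Lorentzian.E4) w₁ w₂ - Literature.Geometry.Lorentzian.Minkowski.bilin w₁ w₂)) → ∀ [g.HasLeviCivita], ∀ ψ : ↥U → ℝ, ContMDiff (modelWithCornersSelf ℝ Literature.Geometry.Lorentzian.E4) (modelWithCornersSelf ℝ ℝ) ((⊤ : ℕ∞) : WithTop ℕ∞) ψ → (∀ x : ↥U, 0 < (x : Literature.Geometry.Lorentzian.E4) 0 → g.toPseudoRiemannianMetric.dalembertian ψ x = 0) → (∃ K : Set ↥U, IsCompact K ∧ ∀ x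 : ↥U, (x : Literature.Geometry.Lorentzian.E4) 0 = 0 → x ∉ K → ψ x = 0 ∧ mfderiv (modelWithCornersSelf ℝ Literature.Geometry.Lorentzian.E4) (modelWithCornersSelf ℝ ℝ) ψ x = 0) → (∀ τ : ℝ, 0 ≤ τ → Literature.Geometry.Lorentzian.sliceEnergy U ψ τ ≤ ENNReal.ofReal C * (Literature.Geometry.Lorentzian.sliceEnergy U ψ 0 + ENNReal.ofReal ((M₁ + M₂) ^ 2) * Finset.univ.sum (fun μ : Fin 4 ↦ Literature.Geometry.Lorentzian.sliceEnergy U (fun x ↦ (mfderiv (modelWithCornersSelf ℝ Literature.Geometry.Lorentzian.E4) (modelWithCornersSelf ℝ ℝ) ψ x (EuclideanSpace.single μ (1 : ℝ)) : ℝ)) 0))) ∧ (∀ R : ℝ, D₀ ≤ R → MeasureTheory.lintegral (MeasureTheory.volume.restrict (Set.Ioi (0 : ℝ))) (fun τ ↦ Literature.Geometry.Lorentzian.localSliceEnergy U ψ τ R) ≤ ENNReal.ofReal (C * R) * (Literature.Geometry.Lorentzian.sliceEnergy U ψ 0 + ENNReal.ofReal ((M₁ + M₂) ^ 2) * Finset.univ.sum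 (fun μ : Fin 4 ↦ Literature.Geometry.Lorentzian.sliceEnergy U (fun x ↦ (mfderiv (modelWithCornersSelf ℝ Literature.Geometry.Lorentzian.E4) (modelWithCornersSelf ℝ ℝ) ψ x (EuclideanSpace.single μ (1 : ℝ)) : ℝ)) 0)))

/-- item stmt-FinalStateConjecture-10083 · crux · rank 3 · open · by planner
why it might fail: Known floor is log decay (Burq1998, arXiv:1509.08495); finite-loss ILED needs a polynomial resolvent bound for shells ∪ repeller ∪ heteroclinics, neither normally (arXiv:1003.4640) nor uniformly hyperbolic (Ikawa1988, Vacossin2024); Datchev–Vasy gluing has no convex collar; C·D must hold at ω ~ 1/D.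
sources: WunschZworski2011, NonnenmacherZworski2007, Ikawa1988, Vacossin2024, BourgainDyatlov2018, DatchevVasy2012
[crux] INTEGRATED DECAY ON STATIC TWO-HOLE BACKGROUNDS, UNIFORMLY IN THE SEPARATION (card K1+K3 in
the regime the summit needs). For M₁, M₂ > 0 and a smooth cutoff χ as above ∃ D₀, C > 0 such that
for every separation D ≥ D₀, on the static superposed Kerr–Schild background with Schwarzschild
holes at ±(D/2)e₃, g = η + (1 − χ(r₂/D))(KS₁ − η) + (1 − χ(r₁/D))(KS₂ − η) (exact Schwarzschild(Mᵢ)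
within D/3 of each hole: red-shift at a true Killing horizon and an exact photon sphere;
asymptotically Schwarzschild of mass M₁+M₂), on U = {r₁ > 3M₁/2, r₂ > 3M₂/2}, every smooth solution
of □_g ψ = 0 on {x⁰ > 0} with compactly supported data satisfies ∫₀^∞ localSliceEnergy(τ, 2D) dτ ≤
C·D·E₁, E₁ as in RecedingSKSDecay. Content: one resolvent/ILED bound gluing two normally hyperbolic
photon spheres, the hyperbolic inter-hole repeller and the heteroclinic orbits joining them, with
the inter-hole loss costing no more than the free dwell time ≍ D (engine: Ikawa/Nonnenmacher–Zworski
gap, P(1/2) < 0 automatic for D ≫ M; or Vacossin's FUP gap per azimuthal mode m after reduction by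
the axial Killing field, |m| ≫ 1 being non-trapped between the holes). [difficulty: L] -/
@[route_item "route-FinalStateConjecture-RecedingRepeller", crux]
def StaticSKSDecay : Prop :=
  ∀ (M₁ M₂ : ℝ), 0 < M₁ → 0 < M₂ → ∀ (χ : ℝ → ℝ), ContDiff ℝ ((⊤ : ℕ∞) : WithTop ℕ∞) χ → (∀ s : ℝ, s ≤ 1 / 3 → χ s = 1) → (∀ s : ℝ, 1 / 2 ≤ s → χ s = 0) → ∃ (D₀ C : ℝ), 0 < D₀ ∧ 0 < C ∧ ∀ D : ℝ, D₀ ≤ D → ∀ (U : TopologicalSpace.Opens Literature.Geometry.Lorentzian.E4), (U : Set Literature.Geometry.Lorentzian.E4) = {x | 3 * M₁ / 2 < Literature.Geometry.Lorentzian.Kerr.radius 0 (x - (D / 2) • EuclideanSpace.single (3 : Fin 4) (1 : ℝ)) ∧ 3 * M₂ / 2 < Literature.Geometry.Lorentzian.Kerr.radius 0 (x + (D / 2) • EuclideanSpace.single (3 : Fin 4) (1 : ℝ))} → ∀ (g : Literature.Geometry.Lorentzian.LorentzianMetric (modelWithCornersSelf ℝ Literature.Geometry.Lorentzian.E4) ((⊤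 : ℕ∞) : WithTop ℕ∞) ↥U), (∀ (x : ↥U) (v w : Literature.Geometry.Lorentzian.E4), g.val x v w = Literature.Geometry.Lorentzian.Minkowski.bilin v w + (1 - χ (Literature.Geometry.Lorentzian.Kerr.radius 0 ((x : Literature.Geometry.Lorentzian.E4) + (D / 2) • EuclideanSpace.single (3 : Fin 4) (1 : ℝ)) / D)) * (Literature.Geometry.Lorentzian.Kerr.bilin M₁ 0 ((x : Literature.Geometry.Lorentzian.E4) - (D / 2) • EuclideanSpace.single (3 : Fin 4) (1 : ℝ)) v w - Literature.Geometry.Lorentzian.Minkowski.bilin v w) + (1 - χ (Literature.Geometry.Lorentzian.Kerr.radius 0 ((x : Literature.Geometry.Lorentzian.E4) - (D / 2) • EuclideanSpace.single (3 : Fin 4) (1 : ℝ)) / D)) * (Literature.Geometry.Lorentzian.Kerr.bilin M₂ 0 ((x : Literature.Geometry.Lorentzian.E4) + (D / 2) • EuclideanSpace.single (3 : Fin 4) (1 : ℝ)) v w - Literature.Geometry.Lorentzian.Minkowski.bilin v w)) → ∀ [g.HasLeviCivita], ∀ ψ : ↥U → ℝ, ContMDiff (modelWithCornersSelf ℝ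 Literature.Geometry.Lorentzian.E4) (modelWithCornersSelf ℝ ℝ) ((⊤ : ℕ∞) : WithTop ℕ∞) ψ → (∀ x : ↥U, 0 < (x : Literature.Geometry.Lorentzian.E4) 0 → g.toPseudoRiemannianMetric.dalembertian ψ x = 0) → (∃ K : Set ↥U, IsCompact K ∧ ∀ x : ↥U, (x : Literature.Geometry.Lorentzian.E4) 0 = 0 → x ∉ K → ψ x = 0 ∧ mfderiv (modelWithCornersSelf ℝ Literature.Geometry.Lorentzian.E4) (modelWithCornersSelf ℝ ℝ) ψ x = 0) → MeasureTheory.lintegral (MeasureTheory.volume.restrict (Set.Ioi (0 : ℝ))) (fun τ ↦ Literature.Geometry.Lorentzian.localSliceEnergy U ψ τ (2 * D)) ≤ ENNReal.ofReal (C * D) * (Literature.Geometry.Lorentzian.sliceEnergy U ψ 0 + ENNReal.ofReal ((M₁ + M₂) ^ 2) * Finset.univ.sum (fun μ : Fin 4 ↦ Literature.Geometry.Lorentzian.sliceEnergy U (fun x ↦ (mfderiv (modelWithCornersSelf ℝ Literature.Geometry.Lorentzian.E4) (modelWithCornersSelf ℝ ℝ) ψ x (EuclideanSpace.single μ (1 :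 ℝ)) : ℝ)) 0))

/-- item stmt-FinalStateConjecture-10084 · crux · rank 4 · open · by planner
why it might fail: The conjecture minus rates: weak censorship, no eternal non-Kerr breathers (only time-periodic ones excluded, AlexakisSchlue2018), no endless merger cascade, generic sub-extremality (extremal holes form, KehleUnger2025) all sit inside; ∀ k exceeds the C² Statement; codim-1 genericity may fail.
sources: Christodoulou1999, Christodoulou2008, DafermosLuk2017, Klainerman2025, Penrose1982, AlexakisSchlue2018
[crux] GENERIC DATA SHADOW A RECEDING MULTI-KERR CONFIGURATION (the complementary half: censorship +
no other attractor, in orbital form). For every k and every positive tolerance ε(N, mass, spin,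
motion), the property "D has a maximal VacuumCauchyDevelopment, and every maximal one has complete
𝓘⁺ (HasCompleteNullInfinity) and carries an ε-shadow in Cᵏ (verbatim the hypothesis of
MultiKerrBasin)" is Christodoulou-generic with codimension 1 in admissibleVacuumData X, for every
admissible 3-manifold X. It contains weak cosmic censorship, MGHD existence in the typed setting,
finiteness of N, sub-extremality of the limiting holes and recession; it asserts closeness but no
rate, and it is implied by the Statement only for k = 2. [difficulty: open-problem] -/
@[route_item "route-FinalStateConjecture-RecedingRepeller", crux]
def GenericShadowing : Prop :=
  ∀ (k : ℕ) (ε : (N : ℕ) → (Fin N → ℝ) → (Fin N → ℝ) → (Fin N → ↥Literature.Geometry.Lorentzian.lorentzGroup × Literature.Geometry.Lorentzian.E4) → ENNReal), (∀ (N : ℕ) (mass spin : Fin N → ℝ) (motion : Fin N → ↥Literature.Geometry.Lorentzian.lorentzGroup × Literature.Geometry.Lorentzian.E4), 0 < ε N mass spin motion) → ∀ (X : Type) [TopologicalSpace X] [ChartedSpace Literature.Geometry.Lorentzian.E3 X] [IsManifold (𝓡 3) ((⊤ : ℕ∞) : WithTop ℕ∞) X] [T2Space X] [SecondCountableTopology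 X] [ConnectedSpace X], Literature.Geometry.Lorentzian.InitialDataSet.IsChristodoulouGeneric (Literature.Geometry.Lorentzian.admissibleVacuumData X) (fun D ↦ (∃ 𝒟 : Literature.Geometry.Lorentzian.VacuumCauchyDevelopment D, 𝒟.IsMaximal) ∧ ∀ 𝒟 : Literature.Geometry.Lorentzian.VacuumCauchyDevelopment D, 𝒟.IsMaximal → Summit.FinalStateConjecture.HasCompleteNullInfinity 𝒟.toCauchyDevelopment ∧ (∃ (N : ℕ) (mass spin : Fin N → ℝ) (motion : Fin N → ↥Literature.Geometry.Lorentzian.lorentzGroup × Literature.Geometry.Lorentzian.E4) (τ₀ : ℝ) (chart : ∀ i : Fin N, ↥(Literature.Geometry.Lorentzian.boostedKerrExterior (motion i).1 (motion i).2 (mass i) (spin i)) → 𝒟.carrier) (Rnz excision : Fin N → ℝ → ℝ) (U₀ : TopologicalSpace.Opens Literature.Geometry.Lorentzian.E4) (flatChart : ↥U₀ → 𝒟.carrier), let bg : Fin N → Literature.Geometry.Lorentzian.ModelBackground := fun i ↦ Literature.Geometry.Lorentzian.boostedKerrBackground (motion i).1 (motion i).2 (mass i) (spin i); let fl : Literature.Geometry.Lorentzian.ModelBackground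 := Literature.Geometry.Lorentzian.Minkowski.backgroundOn U₀; let O : Set 𝒟.carrier := Summit.FinalStateConjecture.exteriorOf 𝒟.toCauchyDevelopment ((⋃ i, chart i '' (bg i).lateRegion τ₀) ∪ flatChart '' fl.lateRegion τ₀); (∀ i, Literature.Geometry.Lorentzian.Kerr.IsSubextremal (mass i) (spin i)) ∧ (∀ i, 𝒟.toSpacetime.IsLateChart (bg i) O τ₀ (chart i)) ∧ 𝒟.toSpacetime.IsLateChart fl O τ₀ flatChart ∧ (∀ i, Filter.Tendsto (Rnz i) Filter.atTop Filter.atTop) ∧ (∀ i (τ : ℝ), τ₀ ≤ τ → 𝒟.toSpacetime.truncDeviationCk (bg i) (chart i) k (Rnz i τ) τ ≤ ε N mass spin motion) ∧ (∀ τ : ℝ, τ₀ ≤ τ → 𝒟.toSpacetime.deviationCk fl flatChart k τ ≤ ε N mass spin motion) ∧ (∀ ρ : ℝ, ∃ τ₁ : ℝ, Pairwise (Function.onFun Disjoint fun i ↦ chart i '' (bg i).truncLateRegion τ₁ ρ)) ∧ (∀ i, Filter.Tendsto (fun t ↦ excision i t / t) Filter.atTop (nhds 0)) ∧ ({x : Literature.Geometry.Lorentzian.E4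 | τ₀ < x 0 ∧ ∀ i, excision i (x 0) < Literature.Geometry.Lorentzian.Kerr.radius (spin i) (Literature.Geometry.Lorentzian.poincareInv (motion i).1 (motion i).2 x)} ⊆ (U₀ : Set Literature.Geometry.Lorentzian.E4)) ∧ (∀ τ₁ : ℝ, τ₀ < τ₁ → O \ (flatChart '' fl.lateRegion τ₁ ∪ ⋃ i, chart i '' {x | τ₁ < (bg i).time x.1 ∧ (bg i).radius x.1 ≤ Rnz i ((bg i).time x.1)}) ⊆ 𝒟.toSpacetime.metric.causalPast 𝒟.toSpacetime.timeOrientation (flatChart '' fl.timeSlab τ₁ ∪ ⋃ i, chart i '' (bg i).truncTimeSlab (Rnz i τ₁) τ₁)))) 1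

/-- item stmt-FinalStateConjecture-10085 · assembly · rank 1 · open · by planner
sources: Christodoulou1999, DafermosLuk2017
[assembly] RecedingSKSDecay → StaticSKSDecay → MultiKerrBasin → GenericShadowing →
FinalStateConjecture (by decl name; the deciding theorem `closes` has exactly these four
hypotheses). -/
@[route_item "route-FinalStateConjecture-RecedingRepeller"]
def Assembly : Prop :=
  RecedingSKSDecay → StaticSKSDecay → MultiKerrBasin → GenericShadowing → _root_.FinalStateConjecture

/-! D-0027 §2.1 — DECIDING THEOREM (planner-authored via `route open/edit --closes-file`; by planner-plancard-FinalStateConjecture-FinalSt-48df0a02-0 2026-08-15T15:06:47Z):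
its hypotheses are this route's items and its conclusion the sub-problem Statement (glue_lint), and it elaborates with this file. -/

@[closes "route-FinalStateConjecture-RecedingRepeller"] theorem closes (h₂ : RecedingSKSDecay) (h₃ : StaticSKSDecay) (h₀ : MultiKerrBasin)
    (h₄ : GenericShadowing) : _root_.FinalStateConjecture := by
  obtain ⟨k, ε, hε, hB⟩ := h₀
  intro X _ _ _ _ _ _
  have hC := h₄ k ε hε X
  unfold Literature.Geometry.Lorentzian.InitialDataSet.IsChristodoulouGeneric Literature.Geometry.Lorentzian.InitialDataSet.HasCodimAtLeastIn at hC ⊢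
  intro d hd
  obtain ⟨F, hF, h0, hinj, hadm, hexc⟩ := hC d ⟨hd.1, fun h ↦ hd.2 ⟨h.1, fun 𝒟 h𝒟 ↦
    ⟨(h.2 𝒟 h𝒟).1, hB X d hd.1 𝒟 h𝒟 (h.2 𝒟 h𝒟).1 (h.2 𝒟 h𝒟).2⟩⟩⟩
  exact ⟨F, hF, h0, hinj, hadm, fun c hc hmem ↦ hexc c hc ⟨hmem.1, fun h ↦ hmem.2 ⟨h.1, fun 𝒟 h𝒟 ↦
    ⟨(h.2 𝒟 h𝒟).1, hB X (F c) (hadm c) 𝒟 h𝒟 (h.2 𝒟 h𝒟).1 (h.2 𝒟 h𝒟).2⟩⟩⟩⟩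

end Summit.FinalStateConjecture.FinalStateConjecture.Theses.RecedingRepeller
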